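import Summits.Ventures.CertifiedManyBodySolver.Upper.DWaveSourceOpenClusterCapTTPrime
import Literature.MathematicalPhysics.QuantumLattice.DWaveSourceNNNHoppingFlatTwist
import Literature.MathematicalPhysics.QuantumLattice.DWaveSourceNNNHoppingOrderParameter
import HarnessLib

/-!
# Cluster trial states for the flat-twisted pair-sourced `t–t'` torus: the open `a × b` cluster with the SPIRAL
# `d`-wave source, and the ceiling `E₀(H_L(h, q)) ≤ Kx·Ky·⟨φ, C^{tt'}_n φ⟩`

HONEST FRAMING: first certified bounds; not a superconductivity verdict; every number certified or labelled float.
Nothing in this file is a number: it is a soundness edge (cluster trial state ⇒ energy CEILING) for the Hubbard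
cuprate cell's instrument row T8 «sourced helicity chord» (`hubbard-cq`, card `sourced-helicity-chord`; lead RULING 115,
critic-1's sharpening «the ceiling side needs no new engine class»).

The flat-twisted sourced torus `dWaveSourceTorusTT'Twist L t' U μ h n` (Literature `DWaveSourceNNNHoppingFlatTwist`:
every bond `x → x + e` carries `χ(n·e)`, `χ = e^{2πi·/L}`, `n ∈ (ℤ/L)²`, twist wave vector `q = 4πn/L`; uniform real
`d`-wave source) is unitarily the UNTWISTED `t–t'` torus with the SPIRAL pair source `Δ_d^{(2n)} = spiralPairField`
(`groundEnergy_dWaveSourceTorusTT'Twist`). In that picture the hopping is real, so the block cut of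
`SourcedHubbardBlockCut` / `DWaveSourceOpenClusterCut` applies verbatim with the spiral pair WEIGHTS
`w_n(x, x+e) = χ(2n·x) · (ĝ_d(e)/√2) · χ(n·e)`; the one new requirement is that the spiral be BLOCK-PERIODIC,
`2n₁·a = 0 = 2n₂·b` in `ℤ/L` (i.e. `q·(a, b) ∈ 2πℤ²`; at `q = (2π/4)·x̂` the block side along `x̂` is a multiple of 4),
so that every block sees the same cluster operator.

* `spiralTorusPairWeight`, `spiralBoxPairWeight`, `spiralPairField_eq_sum_bondPair` (`Δ_d^{(2n)} = Σ_z w_n(z) b_z`),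
  `spiralSourcedTorus_eq_sourcedForm`;
* **`spiralSourceOpenBoxTT' L n a b t' U μ h`** — the open `a × b` `t–t'` cluster with the spiral source (the engine's
  datum: ONE complex Hermitian ED per cell); Hermitian, even;
* `spiralTorusPairWeight_blockSite` (block compatibility under block-periodicity), `spiralSourcedTorus_sub_sum_jwEmbed_eq`
  (the cut), **`expect_prodFamily_spiralSourcedTorusTT'`** (`⟨⊗_R φ, (K_L − h(Δ^{(2n)} + h.c.)) ⊗_R φ⟩ = Kx Ky ⟨φ, C^{tt'}_n φ⟩`);
* **`groundEnergy_dWaveSourceTorusTT'Twist_le_mul_expect_spiralOpenBox`**: for `L = Kx a = Ky b ≥ 3`, `a, b < L`,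
  `2n₁a = 2n₂b = 0 (mod L)` and every even unit cluster vector `φ`,
  `E₀(dWaveSourceTorusTT'Twist L t' U μ h n) ≤ Kx Ky · Re⟨φ, C^{tt'}_n φ⟩`; per-site form `…_le_div_mul_sq`.

References: D. Ruelle, *Statistical Mechanics* (1969) §3.3 [Ruelle1969]; T. Koma, H. Tasaki, J. Stat. Phys. 76 (1994)
745, §1 [KomaTasaki1994]; H. Watanabe, J. Stat. Phys. 177 (2019) 717, §2.2.1 [Watanabe2019].
-/

noncomputable section

namespace Summit.Ventures.CertifiedManyBodySolver

open Matrix Finset Literature.Probability.LatticeModels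
open Literature.MathematicalPhysics.QuantumLattice Literature.MathematicalPhysics.QuantumLattice.ThermodynamicLimit
open Literature.MathematicalPhysics.QuantumLattice.TwoCluster Literature.Barriers.HubbardSuperconductivity
open TorusRectBlock ClusterParity HubbardWave0
open scoped ComplexOrder

/-! ### Spiral pair weights and the sourced form of the untwisted picture -/

section Weights

variable (L : ℕ) [NeZero L]

/-- The pair weights of the SPIRAL torus pair field `Δ_d^{(2n)}`:
`w_n(x, y) = Σ_{e} 1[y = x + e] χ(2n·x) · (ĝ_d(e)/√2) · χ(n·e)`. [cite: KomaTasaki1994, §1] -/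
def spiralTorusPairWeight (n : Fin 2 → ZMod L) (z : FermionTorus 2 L × FermionTorus 2 L) : ℂ :=
  ∑ e ∈ insert (0 : Site 2) unitSteps,
    if FermionTorus.ofTorusSite (FermionTorus.toTorusSite z.1 + Torus.proj L e) = z.2 then
      (ZMod.stdAddChar ((n 0 + n 0) * FermionTorus.toTorusSite z.1 0 + (n 1 + n 1) * FermionTorus.toTorusSite z.1 1) : ℂ) *
        (((dWaveFormFactor e / Real.sqrt 2 : ℝ) : ℂ) *
          (ZMod.stdAddChar (n 0 * Torus.proj L e 0 + n 1 * Torus.proj L e 1) : ℂ))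
    else 0

/-- The spiral pair weights of the OPEN `a × b` cluster (box coordinates read in `ℤ/L`). [cite: KomaTasaki1994, §1] -/
def spiralBoxPairWeight (n : Fin 2 → ZMod L) (a b : ℕ) (z : (Fin a ×ₗ Fin b) × (Fin a ×ₗ Fin b)) : ℂ :=
  ∑ e ∈ insert (0 : Site 2) unitSteps,
    if ((((ofLex z.2).1 : ℕ) : ℤ) = (((ofLex z.1).1 : ℕ) : ℤ) + e 0 ∧
        (((ofLex z.2).2 : ℕ) : ℤ) = (((ofLex z.1).2 : ℕ) : ℤ) + e 1) then
      (ZMod.stdAddChar ((n 0 + n 0) * (((ofLex z.1).1 : ℕ) : ZMod L) + (n 1 + n 1) * (((ofLex z.1).2 : ℕ) : ZMod L)) : ℂ) *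
        (((dWaveFormFactor e / Real.sqrt 2 : ℝ) : ℂ) *
          (ZMod.stdAddChar (n 0 * Torus.proj L e 0 + n 1 * Torus.proj L e 1) : ℂ))
    else 0

/-- The nearest-neighbour part of the open spiral-sourced cluster:
`hamiltonianWith (rectBoxGraph a b) 1 U μ − h(P_n + P_nᴴ)`, `P_n = Σ_z w^C_n(z) b_z`. [cite: KomaTasaki1994, §1] -/
def spiralSourceOpenBoxNN (n : Fin 2 → ZMod L) (a b : ℕ) (U μ h : ℝ) :
    Matrix (Finset (Orb (Fin a ×ₗ Fin b))) (Finset (Orb (Fin a ×ₗ Fin b))) ℂ :=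
  hamiltonianWith (rectBoxGraph a b) 1 U μ -
    (h : ℂ) • ((∑ z : (Fin a ×ₗ Fin b) × (Fin a ×ₗ Fin b), spiralBoxPairWeight L n a b z • bondPair z.1 z.2) +
      (∑ z : (Fin a ×ₗ Fin b) × (Fin a ×ₗ Fin b), spiralBoxPairWeight L n a b z • bondPair z.1 z.2)ᴴ)

/-- **The open `a × b` `t–t'` cluster with the SPIRAL `d`-wave source** (free boundary conditions):
`C^{tt'}_n = hamiltonianWith (rectBoxGraph a b) 1 U μ − h(P_n + P_nᴴ) + hamiltonian (rectBoxDiagGraph a b) t' 0`,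
`P_n = Σ_z w^C_n(z) b_z` — the engine's datum is `⟨φ, C^{tt'}_n φ⟩` for an even unit `φ`. [cite: KomaTasaki1994, §1] -/
def spiralSourceOpenBoxTT' (n : Fin 2 → ZMod L) (a b : ℕ) (tp U μ h : ℝ) :
    Matrix (Finset (Orb (Fin a ×ₗ Fin b))) (Finset (Orb (Fin a ×ₗ Fin b))) ℂ :=
  spiralSourceOpenBoxNN L n a b U μ h + hamiltonian (rectBoxDiagGraph a b) tp 0

/-- The spiral-sourced open cluster is Hermitian. [cite: KomaTasaki1994, §1] -/
theorem spiralSourceOpenBoxTT'_isHermitian (n : Fin 2 → ZMod L) (a b : ℕ) (tp U μ h : ℝ) :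
    (spiralSourceOpenBoxTT' L n a b tp U μ h).IsHermitian :=
  (isHermitian_sourced (rectBoxGraph a b) 1 U μ h (spiralBoxPairWeight L n a b)).add
    (hamiltonian_isHermitian_and_commute_holds (rectBoxDiagGraph a b) tp 0).1

/-- The nearest-neighbour part of the spiral-sourced open cluster is even. [folklore] -/
theorem isParityPreserving_spiralSourceOpenBoxNN (n : Fin 2 → ZMod L) (a b : ℕ) (U μ h : ℝ) :
    IsParityPreserving (spiralSourceOpenBoxNN L n a b U μ h) := by
  unfold spiralSourceOpenBoxNN
  exact isParityPreserving_sub (isParityPreserving_hamiltonianWith _ 1 U μ)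
    (((isParityPreserving_sum_smul_bondPair _).add
      (isParityPreserving_conjTranspose (isParityPreserving_sum_smul_bondPair _))).smul _)

/-- The spiral-sourced open cluster is even. [folklore] -/
theorem isParityPreserving_spiralSourceOpenBoxTT' (n : Fin 2 → ZMod L) (a b : ℕ) (tp U μ h : ℝ) :
    IsParityPreserving (spiralSourceOpenBoxTT' L n a b tp U μ h) :=
  (isParityPreserving_spiralSourceOpenBoxNN L n a b U μ h).add (isParityPreserving_hamiltonian _ tp 0)

/-- `bondPairAnn` (QuantumLattice) and `bondPair` (Barriers) are the same matrix. [folklore] -/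
theorem bondPairAnn_eq_bondPair {Λ : Type*} [LinearOrder Λ] [Fintype Λ] (y z : Λ) : bondPairAnn y z = bondPair y z :=
  rfl

/-- **`Δ_d^{(2n)} = Σ_{(x,y)} w_n(x,y) b_{xy}`** on the torus. [cite: KomaTasaki1994, §1] -/
theorem spiralPairField_eq_sum_bondPair (n : Fin 2 → ZMod L) :
    spiralPairField L dWaveFormFactor n =
      ∑ z : FermionTorus 2 L × FermionTorus 2 L, spiralTorusPairWeight L n z • bondPair z.1 z.2 := by
  rw [spiralPairField, Fintype.sum_prod_type]
  rw [← (FermionTorus.equivTorusSite (d := 2) (L := L)).sum_comp]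
  refine Finset.sum_congr rfl fun x _ => ?_
  show (ZMod.stdAddChar ((n 0 + n 0) * FermionTorus.toTorusSite x 0 + (n 1 + n 1) * FermionTorus.toTorusSite x 1) : ℂ) •
      spiralLocalPair L dWaveFormFactor n (FermionTorus.toTorusSite x) = _
  have hloc : spiralLocalPair L dWaveFormFactor n (FermionTorus.toTorusSite x) =
      ∑ e ∈ insert (0 : Site 2) unitSteps, (((dWaveFormFactor e / Real.sqrt 2 : ℝ) : ℂ) *
          (ZMod.stdAddChar (n 0 * Torus.proj L e 0 + n 1 * Torus.proj L e 1) : ℂ)) •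
        bondPair x (FermionTorus.ofTorusSite (FermionTorus.toTorusSite x + Torus.proj L e)) := by
    rw [spiralLocalPair, FermionTorus.ofTorusSite_toTorusSite]
    refine Finset.sum_congr rfl fun e _ => ?_
    rw [smul_smul, bondPairAnn_eq_bondPair]
  rw [hloc, Finset.smul_sum]
  -- insert the Kronecker delta in `y` and exchange the sums
  have hδ : ∀ e : Site 2,
      (ZMod.stdAddChar ((n 0 + n 0) * FermionTorus.toTorusSite x 0 + (n 1 + n 1) * FermionTorus.toTorusSite x 1) : ℂ) •
        ((((dWaveFormFactor e / Real.sqrt 2 : ℝ) : ℂ) *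
            (ZMod.stdAddChar (n 0 * Torus.proj L e 0 + n 1 * Torus.proj L e 1) : ℂ)) •
          bondPair x (FermionTorus.ofTorusSite (FermionTorus.toTorusSite x + Torus.proj L e))) =
      ∑ y : FermionTorus 2 L, (if FermionTorus.ofTorusSite (FermionTorus.toTorusSite x + Torus.proj L e) = y then
        (ZMod.stdAddChar ((n 0 + n 0) * FermionTorus.toTorusSite x 0 + (n 1 + n 1) * FermionTorus.toTorusSite x 1) : ℂ) *
          (((dWaveFormFactor e / Real.sqrt 2 : ℝ) : ℂ) *
            (ZMod.stdAddChar (n 0 * Torus.proj L e 0 + n 1 * Torus.proj L e 1) : ℂ)) else 0) • bondPair x y := by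
    intro e
    simp only [ite_smul, zero_smul, Finset.sum_ite_eq, Finset.mem_univ, if_true, smul_smul]
  rw [Finset.sum_congr rfl fun e _ => hδ e, Finset.sum_comm]
  refine Finset.sum_congr rfl fun y _ => ?_
  rw [spiralTorusPairWeight, Finset.sum_smul]

/-- The untwisted torus with the spiral source in the `(graph, weights)` form of `SourcedHubbardBlockCut`, plus the
diagonal hopping: `(H^{tt'} − μN) − h(Δ^{(2n)} + h.c.) = [hamiltonianWith (fermionTorusGraph 2 L) 1 U μ − h(P_n + P_nᴴ)]
+ hamiltonian (fermionTorusDiagGraph L) t' 0`. [cite: KomaTasaki1994, §1] -/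
theorem spiralSourcedTorus_eq_sourcedForm (tp U μ h : ℝ) (n : Fin 2 → ZMod L) :
    (hubbardTorusTT' L 1 tp U - (μ : ℂ) • totalNumber) -
        (h : ℂ) • (spiralPairField L dWaveFormFactor n + (spiralPairField L dWaveFormFactor n)ᴴ) =
      (hamiltonianWith (fermionTorusGraph 2 L) 1 U μ -
          (h : ℂ) • ((∑ z : FermionTorus 2 L × FermionTorus 2 L, spiralTorusPairWeight L n z • bondPair z.1 z.2) +
            (∑ z : FermionTorus 2 L × FermionTorus 2 L, spiralTorusPairWeight L n z • bondPair z.1 z.2)ᴴ)) +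
        hamiltonian (fermionTorusDiagGraph L) tp 0 := by
  rw [hubbardTorusTT'_sub_mu_eq, spiralPairField_eq_sum_bondPair]
  abel

end Weights

/-! ### Block compatibility of the spiral weights under block-periodicity, and the cut -/

section Cut

variable {L Kx Ky a b : ℕ} (hLa : L = Kx * a) (hLb : L = Ky * b)

/-- **The spiral torus weights restricted to one block are the box weights**, provided the spiral is
BLOCK-PERIODIC: `2n₁·a = 0 = 2n₂·b` in `ℤ/L` (`a, b < L`: no wrap-around). [cite: Ruelle1969, §3.3] -/
theorem spiralTorusPairWeight_blockSite [NeZero L] (haL : a < L) (hbL : b < L) {n : Fin 2 → ZMod L}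
    (hper0 : (n 0 + n 0) * (a : ZMod L) = 0) (hper1 : (n 1 + n 1) * (b : ZMod L) = 0) (R : Fin Kx ×ₗ Fin Ky)
    (p q : Fin a ×ₗ Fin b) :
    spiralTorusPairWeight L n (blockSite hLa hLb R p, blockSite hLa hLb R q) = spiralBoxPairWeight L n a b (p, q) := by
  unfold spiralTorusPairWeight spiralBoxPairWeight
  refine Finset.sum_congr rfl fun e he => ?_
  have key : FermionTorus.ofTorusSite (FermionTorus.toTorusSite (blockSite hLa hLb R p) + Torus.proj L e) =
      blockSite hLa hLb R q ↔
      ((((ofLex q).1 : ℕ) : ℤ) = (((ofLex p).1 : ℕ) : ℤ) + e 0 ∧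
        (((ofLex q).2 : ℕ) : ℤ) = (((ofLex p).2 : ℕ) : ℤ) + e 1) := by
    rw [← toTorusSite_blockSite_eq_add_proj_iff hLa hLb haL hbL R p q (abs_apply_le_one_of_mem_insert_unitSteps he)]
    constructor
    · intro h
      rw [← h, FermionTorus.toTorusSite_ofTorusSite]
    · intro h
      rw [← h, FermionTorus.ofTorusSite_toTorusSite]
  have hphase : (n 0 + n 0) * FermionTorus.toTorusSite (blockSite hLa hLb R p) 0 +
        (n 1 + n 1) * FermionTorus.toTorusSite (blockSite hLa hLb R p) 1 =
      (n 0 + n 0) * (((ofLex p).1 : ℕ) : ZMod L) + (n 1 + n 1) * (((ofLex p).2 : ℕ) : ZMod L) := by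
    have h0 : FermionTorus.toTorusSite (blockSite hLa hLb R p) 0 =
        (((ofLex R).1 : ℕ) : ZMod L) * (a : ZMod L) + (((ofLex p).1 : ℕ) : ZMod L) := by
      show (((ofLex (blockSite hLa hLb R p)) 0 : ℕ) : ZMod L) = _
      rw [blockSite_apply_zero]; push_cast; ring
    have h1 : FermionTorus.toTorusSite (blockSite hLa hLb R p) 1 =
        (((ofLex R).2 : ℕ) : ZMod L) * (b : ZMod L) + (((ofLex p).2 : ℕ) : ZMod L) := by
      show (((ofLex (blockSite hLa hLb R p)) 1 : ℕ) : ZMod L) = _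
      rw [blockSite_apply_one]; push_cast; ring
    rw [h0, h1]
    linear_combination (((ofLex R).1 : ℕ) : ZMod L) * hper0 + (((ofLex R).2 : ℕ) : ZMod L) * hper1
  by_cases hc : ((((ofLex q).1 : ℕ) : ℤ) = (((ofLex p).1 : ℕ) : ℤ) + e 0 ∧
      (((ofLex q).2 : ℕ) : ℤ) = (((ofLex p).2 : ℕ) : ℤ) + e 1)
  · rw [if_pos (key.2 hc), if_pos hc, hphase]
  · rw [if_neg (fun h => hc (key.1 h)), if_neg hc]

/-- **The block cut of the spiral-sourced (untwisted-hopping) torus** (`L = Kx a = Ky b`, `a, b < L`, block-periodic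
spiral): the nearest-neighbour part minus the embedded spiral-sourced open clusters is minus the inter-block hopping and
minus `h` times the inter-block source bonds. [cite: Ruelle1969, §3.3] -/
theorem spiralSourcedTorus_sub_sum_jwEmbed_eq [NeZero L] (haL : a < L) (hbL : b < L) (U μ h : ℝ) {n : Fin 2 → ZMod L}
    (hper0 : (n 0 + n 0) * (a : ZMod L) = 0) (hper1 : (n 1 + n 1) * (b : ZMod L) = 0) :
    (hamiltonianWith (fermionTorusGraph 2 L) 1 U μ -
          (h : ℂ) • ((∑ z : FermionTorus 2 L × FermionTorus 2 L, spiralTorusPairWeight L n z • bondPair z.1 z.2) +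
            (∑ z : FermionTorus 2 L × FermionTorus 2 L, spiralTorusPairWeight L n z • bondPair z.1 z.2)ᴴ)) -
        ∑ R : Fin Kx ×ₗ Fin Ky, jwEmbed (blockOrbEmb hLa hLb R) (spiralSourceOpenBoxNN L n a b U μ h) =
      -(∑ b ∈ (Finset.univ.biUnion fun R : Fin Kx ×ₗ Fin Ky =>
            (Finset.univ : Finset (Bond (Fin a ×ₗ Fin b))).map ⟨bondMap (blockSiteEmb hLa hLb R), bondMap_injective _⟩)ᶜ,
          hubbardCoupling (fermionTorusGraph 2 L) ((1 : ℝ) : ℂ) b • bondOp b) -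
        (h : ℂ) • ((∑ z ∈ (Finset.univ.biUnion fun R : Fin Kx ×ₗ Fin Ky =>
              (Finset.univ : Finset ((Fin a ×ₗ Fin b) × (Fin a ×ₗ Fin b))).map
                ⟨Prod.map (blockSiteEmb hLa hLb R) (blockSiteEmb hLa hLb R),
                  (blockSiteEmb hLa hLb R).injective.prodMap (blockSiteEmb hLa hLb R).injective⟩)ᶜ,
            spiralTorusPairWeight L n z • bondPair z.1 z.2) +
          (∑ z ∈ (Finset.univ.biUnion fun R : Fin Kx ×ₗ Fin Ky =>
              (Finset.univ : Finset ((Fin a ×ₗ Fin b) × (Fin a ×ₗ Fin b))).map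
                ⟨Prod.map (blockSiteEmb hLa hLb R) (blockSiteEmb hLa hLb R),
                  (blockSiteEmb hLa hLb R).injective.prodMap (blockSiteEmb hLa hLb R).injective⟩)ᶜ,
            spiralTorusPairWeight L n z • bondPair z.1 z.2)ᴴ) := by
  have hcut := sourced_sub_sum_jwEmbed_sub_onSiteSum_eq (Finset.univ : Finset (Fin Kx ×ₗ Fin Ky))
    (blockSiteEmb hLa hLb) (fun R _ R' _ hne x y => blockSite_ne_of_ne hLa hLb hne x y)
    (fermionTorusGraph 2 L) (rectBoxGraph a b)
    (fun R _ x y => (fermionTorusGraph_adj_blockSite_iff hLa hLb haL hbL R x y).symm) 1 U μ h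
    (spiralTorusPairWeight L n) (spiralBoxPairWeight L n a b)
    (fun R _ z => (spiralTorusPairWeight_blockSite hLa hLb haL hbL hper0 hper1 R z.1 z.2).symm)
  have hrest : onSiteSum (U : ℂ) (μ : ℂ) (Finset.univ.biUnion fun R : Fin Kx ×ₗ Fin Ky =>
      (Finset.univ : Finset (Fin a ×ₗ Fin b)).map (blockSiteEmb hLa hLb R).toEmbedding)ᶜ = 0 := by
    rw [biUnion_map_blockSiteEmb_eq_univ, Finset.compl_univ, onSiteSum, Finset.sum_empty]
  rw [hrest, sub_zero] at hcut
  exact hcut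

/-- **Expectation of the nearest-neighbour spiral-sourced part in the tiled product of an even unit cluster vector**:
`Kx Ky ⟨φ, (hamiltonianWith_C − h(P_n + P_nᴴ)) φ⟩`. [cite: Ruelle1969, §3.3] -/
theorem expect_prodFamily_spiralSourcedNN [NeZero L] (haL : a < L) (hbL : b < L) (U μ h : ℝ) {n : Fin 2 → ZMod L}
    (hper0 : (n 0 + n 0) * (a : ZMod L) = 0) (hper1 : (n 1 + n 1) * (b : ZMod L) = 0)
    {ψ : Fock (Orb (Fin a ×ₗ Fin b))} (hψ : HasParity 0 ψ) (hψ1 : star ψ ⬝ᵥ ψ = 1) :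
    star ((rectBlockPartition hLa hLb).prodFamily fun _ => ψ) ⬝ᵥ
        ((hamiltonianWith (fermionTorusGraph 2 L) 1 U μ -
            (h : ℂ) • ((∑ z : FermionTorus 2 L × FermionTorus 2 L, spiralTorusPairWeight L n z • bondPair z.1 z.2) +
              (∑ z : FermionTorus 2 L × FermionTorus 2 L, spiralTorusPairWeight L n z • bondPair z.1 z.2)ᴴ)) *ᵥ
          (rectBlockPartition hLa hLb).prodFamily fun _ => ψ) =
      ((Kx * Ky : ℕ) : ℂ) * (star ψ ⬝ᵥ (spiralSourceOpenBoxNN L n a b U μ h *ᵥ ψ)) := by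
  have hpar : ∀ R : Fin Kx ×ₗ Fin Ky, HasParity ((fun _ => 0) R) ((fun _ => ψ) R) := fun _ => hψ
  have hcut := spiralSourcedTorus_sub_sum_jwEmbed_eq hLa hLb haL hbL U μ h hper0 hper1
  rw [sub_eq_iff_eq_add'] at hcut
  rw [hcut]
  -- block terms
  have hblock : ∀ R : Fin Kx ×ₗ Fin Ky,
      star ((rectBlockPartition hLa hLb).prodFamily fun _ => ψ) ⬝ᵥ
        (jwEmbed (blockOrbEmb hLa hLb R) (spiralSourceOpenBoxNN L n a b U μ h) *ᵥ
          (rectBlockPartition hLa hLb).prodFamily fun _ => ψ) =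
        star ψ ⬝ᵥ (spiralSourceOpenBoxNN L n a b U μ h *ᵥ ψ) := fun R =>
    star_prodFamily_dotProduct_jwEmbed_eq (rectBlockPartition hLa hLb)
      (isParityPreserving_spiralSourceOpenBoxNN L n a b U μ h) R (fun _ => hψ1)
  -- inter-block hopping
  have hbond : ∀ bd ∈ (Finset.univ.biUnion fun R : Fin Kx ×ₗ Fin Ky =>
      (Finset.univ : Finset (Bond (Fin a ×ₗ Fin b))).map ⟨bondMap (blockSiteEmb hLa hLb R), bondMap_injective _⟩)ᶜ,
      star ((rectBlockPartition hLa hLb).prodFamily fun _ => ψ) ⬝ᵥ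
        (bondOp bd *ᵥ (rectBlockPartition hLa hLb).prodFamily fun _ => ψ) = 0 := fun bd hbd =>
    star_prodFamily_dotProduct_hop_eq_zero hLa hLb hpar (blockOf_ne_of_not_mem_bonds hLa hLb (Finset.mem_compl.1 hbd)) _ _
  -- inter-block source bonds
  have hpair : ∀ z ∈ (Finset.univ.biUnion fun R : Fin Kx ×ₗ Fin Ky =>
      (Finset.univ : Finset ((Fin a ×ₗ Fin b) × (Fin a ×ₗ Fin b))).map
        ⟨Prod.map (blockSiteEmb hLa hLb R) (blockSiteEmb hLa hLb R),
          (blockSiteEmb hLa hLb R).injective.prodMap (blockSiteEmb hLa hLb R).injective⟩)ᶜ,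
      star ((rectBlockPartition hLa hLb).prodFamily fun _ => ψ) ⬝ᵥ
        (bondPair z.1 z.2 *ᵥ (rectBlockPartition hLa hLb).prodFamily fun _ => ψ) = 0 := fun z hz =>
    star_prodFamily_dotProduct_bondPair_eq_zero hLa hLb hpar (blockOf_ne_of_not_mem_pairs hLa hLb (Finset.mem_compl.1 hz))
  have hpair' : ∀ z ∈ (Finset.univ.biUnion fun R : Fin Kx ×ₗ Fin Ky =>
      (Finset.univ : Finset ((Fin a ×ₗ Fin b) × (Fin a ×ₗ Fin b))).map
        ⟨Prod.map (blockSiteEmb hLa hLb R) (blockSiteEmb hLa hLb R),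
          (blockSiteEmb hLa hLb R).injective.prodMap (blockSiteEmb hLa hLb R).injective⟩)ᶜ,
      star ((rectBlockPartition hLa hLb).prodFamily fun _ => ψ) ⬝ᵥ
        ((bondPair z.1 z.2)ᴴ *ᵥ (rectBlockPartition hLa hLb).prodFamily fun _ => ψ) = 0 := fun z hz =>
    star_prodFamily_dotProduct_bondPair_conjTranspose_eq_zero hLa hLb hpar
      (blockOf_ne_of_not_mem_pairs hLa hLb (Finset.mem_compl.1 hz))
  have hB : star ((rectBlockPartition hLa hLb).prodFamily fun _ => ψ) ⬝ᵥ
      ((∑ R : Fin Kx ×ₗ Fin Ky, jwEmbed (blockOrbEmb hLa hLb R) (spiralSourceOpenBoxNN L n a b U μ h)) *ᵥ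
        (rectBlockPartition hLa hLb).prodFamily fun _ => ψ) =
      ((Kx * Ky : ℕ) : ℂ) * (star ψ ⬝ᵥ (spiralSourceOpenBoxNN L n a b U μ h *ᵥ ψ)) := by
    rw [Matrix.sum_mulVec, dotProduct_sum, Finset.sum_congr rfl fun R _ => hblock R, Finset.sum_const,
      Finset.card_univ, card_blocks, nsmul_eq_mul]
  have hS : star ((rectBlockPartition hLa hLb).prodFamily fun _ => ψ) ⬝ᵥ
      ((∑ bd ∈ (Finset.univ.biUnion fun R : Fin Kx ×ₗ Fin Ky =>
          (Finset.univ : Finset (Bond (Fin a ×ₗ Fin b))).map ⟨bondMap (blockSiteEmb hLa hLb R), bondMap_injective _⟩)ᶜ,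
        hubbardCoupling (fermionTorusGraph 2 L) ((1 : ℝ) : ℂ) bd • bondOp bd) *ᵥ
        (rectBlockPartition hLa hLb).prodFamily fun _ => ψ) = 0 := by
    rw [Matrix.sum_mulVec, dotProduct_sum]
    exact Finset.sum_eq_zero fun bd hbd => by rw [Matrix.smul_mulVec, dotProduct_smul, hbond bd hbd, smul_zero]
  have hT : star ((rectBlockPartition hLa hLb).prodFamily fun _ => ψ) ⬝ᵥ
      ((∑ z ∈ (Finset.univ.biUnion fun R : Fin Kx ×ₗ Fin Ky =>
          (Finset.univ : Finset ((Fin a ×ₗ Fin b) × (Fin a ×ₗ Fin b))).map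
            ⟨Prod.map (blockSiteEmb hLa hLb R) (blockSiteEmb hLa hLb R),
              (blockSiteEmb hLa hLb R).injective.prodMap (blockSiteEmb hLa hLb R).injective⟩)ᶜ,
        spiralTorusPairWeight L n z • bondPair z.1 z.2) *ᵥ (rectBlockPartition hLa hLb).prodFamily fun _ => ψ) = 0 := by
    rw [Matrix.sum_mulVec, dotProduct_sum]
    exact Finset.sum_eq_zero fun z hz => by rw [Matrix.smul_mulVec, dotProduct_smul, hpair z hz, smul_zero]
  have hT' : star ((rectBlockPartition hLa hLb).prodFamily fun _ => ψ) ⬝ᵥ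
      ((∑ z ∈ (Finset.univ.biUnion fun R : Fin Kx ×ₗ Fin Ky =>
          (Finset.univ : Finset ((Fin a ×ₗ Fin b) × (Fin a ×ₗ Fin b))).map
            ⟨Prod.map (blockSiteEmb hLa hLb R) (blockSiteEmb hLa hLb R),
              (blockSiteEmb hLa hLb R).injective.prodMap (blockSiteEmb hLa hLb R).injective⟩)ᶜ,
        spiralTorusPairWeight L n z • bondPair z.1 z.2)ᴴ *ᵥ (rectBlockPartition hLa hLb).prodFamily fun _ => ψ) = 0 := by
    rw [conjTranspose_sum, Matrix.sum_mulVec, dotProduct_sum]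
    exact Finset.sum_eq_zero fun z hz => by
      rw [conjTranspose_smul, Matrix.smul_mulVec, dotProduct_smul, hpair' z hz, smul_zero]
  rw [add_mulVec, dotProduct_add, hB, sub_mulVec, dotProduct_sub, neg_mulVec, dotProduct_neg, hS,
    Matrix.smul_mulVec, dotProduct_smul, add_mulVec, dotProduct_add, hT, hT', add_zero, smul_zero, neg_zero,
    sub_zero, add_zero]

/-- **The expectation of the spiral-sourced `t–t'` torus in the tiled product of an even unit cluster vector**:
`⟨⊗_R φ, ((H^{tt'} − μN) − h(Δ^{(2n)} + h.c.)) ⊗_R φ⟩ = Kx Ky ⟨φ, C^{tt'}_n φ⟩` (`L = Kx a = Ky b`, `a, b < L`,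
block-periodic spiral). [cite: Ruelle1969, §3.3] -/
theorem expect_prodFamily_spiralSourcedTorusTT' [NeZero L] (haL : a < L) (hbL : b < L) (tp U μ h : ℝ)
    {n : Fin 2 → ZMod L} (hper0 : (n 0 + n 0) * (a : ZMod L) = 0) (hper1 : (n 1 + n 1) * (b : ZMod L) = 0)
    {φ : Fock (Orb (Fin a ×ₗ Fin b))} (hφ : HasParity 0 φ) (hφ1 : star φ ⬝ᵥ φ = 1) :
    star ((rectBlockPartition hLa hLb).prodFamily fun _ => φ) ⬝ᵥ
        (((hubbardTorusTT' L 1 tp U - (μ : ℂ) • totalNumber) -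
            (h : ℂ) • (spiralPairField L dWaveFormFactor n + (spiralPairField L dWaveFormFactor n)ᴴ)) *ᵥ
          (rectBlockPartition hLa hLb).prodFamily fun _ => φ) =
      ((Kx * Ky : ℕ) : ℂ) * (star φ ⬝ᵥ (spiralSourceOpenBoxTT' L n a b tp U μ h *ᵥ φ)) := by
  rw [spiralSourcedTorus_eq_sourcedForm, spiralSourceOpenBoxTT', add_mulVec, dotProduct_add, add_mulVec, dotProduct_add,
    expect_prodFamily_spiralSourcedNN hLa hLb haL hbL U μ h hper0 hper1 hφ hφ1,
    expect_prodFamily_hamiltonian_fermionTorusDiagGraph hLa hLb haL hbL tp hφ hφ1, mul_add]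

/-- **Cluster variational principle for the flat-twisted pair-sourced `t–t'` torus**: for `L = Kx a = Ky b ≥ 3`,
`a, b < L`, a BLOCK-PERIODIC twist (`2n₁a = 2n₂b = 0` in `ℤ/L`) and every EVEN-parity unit vector `φ` of the open
spiral-sourced `a × b` cluster, `E₀(dWaveSourceTorusTT'Twist L t' U μ h n) ≤ Kx Ky · Re⟨φ, C^{tt'}_n φ⟩`.
[cite: Ruelle1969, §3.3] -/
theorem groundEnergy_dWaveSourceTorusTT'Twist_le_mul_expect_spiralOpenBox [NeZero L] (hLa : L = Kx * a)
    (hLb : L = Ky * b) (haL : a < L) (hbL : b < L) (hL : 3 ≤ L) (tp U μ h : ℝ) {n : Fin 2 → ZMod L}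
    (hper0 : (n 0 + n 0) * (a : ZMod L) = 0) (hper1 : (n 1 + n 1) * (b : ZMod L) = 0)
    {φ : Fock (Orb (Fin a ×ₗ Fin b))} (hφ : HasParity 0 φ) (hφ1 : star φ ⬝ᵥ φ = 1) :
    (dWaveSourceTorusTT'Twist L tp U μ h n).groundEnergy ≤
      ((Kx * Ky : ℕ) : ℝ) * (star φ ⬝ᵥ (spiralSourceOpenBoxTT' L n a b tp U μ h *ᵥ φ)).re := by
  have hunit : star ((rectBlockPartition hLa hLb).prodFamily fun _ => φ) ⬝ᵥ
      ((rectBlockPartition hLa hLb).prodFamily fun _ => φ) = 1 := by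
    rw [(rectBlockPartition hLa hLb).star_prodFamily_dotProduct_prodFamily]
    exact Finset.prod_eq_one fun _ _ => hφ1
  rw [groundEnergy_dWaveSourceTorusTT'Twist L hL]
  have hle := Matrix.groundEnergy_le_rayleigh_holds (isHermitian_spiralSourcedTorus L hL tp U μ h n) _ hunit
  rw [expect_prodFamily_spiralSourcedTorusTT' hLa hLb haL hbL tp U μ h hper0 hper1 hφ hφ1] at hle
  rw [show ((Kx * Ky : ℕ) : ℂ) = (((Kx * Ky : ℕ) : ℝ) : ℂ) by norm_cast, Complex.re_ofReal_mul] at hle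
  exact hle

/-- The same bound per site: `E₀(H_L(h, n)) ≤ (Re⟨φ, C^{tt'}_n φ⟩/(a b)) · L²`. [cite: Ruelle1969, §3.3] -/
theorem groundEnergy_dWaveSourceTorusTT'Twist_le_div_mul_sq [NeZero L] {Kx Ky : ℕ} (hLa : L = Kx * a)
    (hLb : L = Ky * b) (haL : a < L) (hbL : b < L) (hL : 3 ≤ L) (tp U μ h : ℝ) {n : Fin 2 → ZMod L}
    (hper0 : (n 0 + n 0) * (a : ZMod L) = 0) (hper1 : (n 1 + n 1) * (b : ZMod L) = 0)
    {φ : Fock (Orb (Fin a ×ₗ Fin b))} (hφ : HasParity 0 φ) (hφ1 : star φ ⬝ᵥ φ = 1) :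
    (dWaveSourceTorusTT'Twist L tp U μ h n).groundEnergy ≤
      (star φ ⬝ᵥ (spiralSourceOpenBoxTT' L n a b tp U μ h *ᵥ φ)).re / ((a : ℝ) * b) * (L : ℝ) ^ 2 := by
  have ha : 0 < a := Nat.pos_of_ne_zero (by rintro rfl; simp at hLa; omega)
  have hb : 0 < b := Nat.pos_of_ne_zero (by rintro rfl; simp at hLb; omega)
  have hmain := groundEnergy_dWaveSourceTorusTT'Twist_le_mul_expect_spiralOpenBox hLa hLb haL hbL hL tp U μ h hper0 hper1
    hφ hφ1
  have hsq : ((Kx * Ky : ℕ) : ℝ) = (L : ℝ) ^ 2 / ((a : ℝ) * b) := by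
    have hab : ((a : ℝ) * b) ≠ 0 := by positivity
    rw [eq_div_iff hab]
    have : (L : ℝ) ^ 2 = ((Kx * a : ℕ) : ℝ) * ((Ky * b : ℕ) : ℝ) := by rw [← hLa, ← hLb]; ring
    rw [this]; push_cast; ring
  rw [hsq] at hmain
  calc (dWaveSourceTorusTT'Twist L tp U μ h n).groundEnergy
      ≤ (L : ℝ) ^ 2 / ((a : ℝ) * b) * (star φ ⬝ᵥ (spiralSourceOpenBoxTT' L n a b tp U μ h *ᵥ φ)).re := hmain
    _ = _ := by ring

end Cut

end Summit.Ventures.CertifiedManyBodySolver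

end
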